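import Mathlib
import Summits.AtomisticToContinuum.Crystallization.Theses.PhononSlackCertificates
import Summits.AtomisticToContinuum.Crystallization.Theorems.PhononStability.Negative.Mirror
import Summits.AtomisticToContinuum.Crystallization.Theorems.NashClassCertificatesNashNearFieldStubMinimalityOfTubeCoercivity
import Summits.AtomisticToContinuum.Crystallization.Theorems.ExcessDecayLiouvilleHcpLiouvillePairCalculus

/-!
# Crux `PhononSlackCertificates.NearFieldConvexity` (stmt-AtomisticToContinuum-13958), line `Sketch`:
brick `stub_segmentSecondVariation` for the stub `stub_flatnessPaid` (I_flat) — the EXACT second variation of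
Lennard-Jones site energies along a straight segment

The planned proof of the perturbative energy stub expands each site energy
`e_i(x) = ½ Σ_{j ∈ Ω ∖ i} V(|x_i − x_j|)` (`V = lennardJones`) about an affine reference `y` along the straight
segment `y + t·u`, `t ∈ [0, 1]`, and bounds the second variation from below at every `t` by tube coercivity.
This needs the second-order Taylor formula with INTEGRAL remainder (no cubic error term), at the pair level
and summed over the pairs of a finite region:

* `hasDerivAt_lj_along` — `d/dt V(‖e + t b‖) = (V′(r)/r)·⟪e + t b, b⟫`, `r = ‖e + t b‖ ≠ 0`;
* `hasDerivAt_lj_along_deriv` — the derivative of that first derivative is the pair force-constant form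
  `Hess₀ (e + t b) b` (`Hess₀ e w = V″(|e|)(ê·w)² + (V′(|e|)/|e|)(|w|² − (ê·w)²)`, the mirror file's `Hess₀`);
* `lj_pair_second_variation` — if the segment `e + t b`, `t ∈ [0,1]`, avoids the origin, then
  `V(‖e + b‖) = V(‖e‖) + (V′(‖e‖)/‖e‖)⟪e, b⟫ + ∫₀¹ (1 − t)·Hess₀ (e + t b) b dt`
  (fundamental theorem of calculus for `g(t) = φ(t) + (1 − t)φ′(t)`, `g′ = (1 − t)φ″`);
* `lj_pair_second_variation_ge` — hence `V(‖e‖) + (V′(‖e‖)/‖e‖)⟪e, b⟫ + m/2 ≤ V(‖e + b‖)` whenever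
  `m ≤ Hess₀ (e + t b) b` on `[0,1]`;
* `stub_segmentSecondVariation` (THE HEADLINE, registered) — the same identity summed over the ordered pairs
  `(i, j)`, `i ∈ S`, `j ∈ Ω ∖ i`, of a finite configuration `y + t·u` (finite sums commute with the interval
  integral), together with the lower bound obtained from any `t`-dependent minorant `m t` of the summed
  second variation with `(1 − t)·m t` interval integrable:
  `E_S(y) + ⟨∇E_S(y), u⟩ + ∫₀¹ (1 − t) m(t) dt ≤ E_S(y + u)`.

The one-bond calculus is the twin crux's (`NashNearField`, P-min file: `pmin_hasDerivAt_bond`,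
`pmin_hasDerivAt_bond'`, `pmin_profile_eq_deriv_div`) and the continuity of `t ↦ Hess₀ (a + tδ) ξ` along a chord
avoiding the origin is `ExcessDecayLiouville.flatDiff_continuousAt_Hess₀_chord`.  All `[folklore]`; a `--supports`
piece, nothing here closes an item.
-/

noncomputable section

open scoped BigOperators RealInnerProductSpace
open Literature.MathematicalPhysics.StatisticalMechanics
open Summit.AtomisticToContinuum.Crystallization.Theorems.PhononStabilityNegative (Hess₀ deriv_lennardJones)
open Summit.AtomisticToContinuum.Crystallization.Theorems.NashClassCertificatesNashNearField
  (pmin_hasDerivAt_bond pmin_hasDerivAt_bond' pmin_profile_eq_deriv_div)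
open Summit.AtomisticToContinuum.Crystallization.Theorems.ExcessDecayLiouville
  (flatDiff_continuousAt_Hess₀_chord)

namespace Summit.AtomisticToContinuum.Crystallization.Theorems.PhononSlackNearFieldConvexity

/-! ## One bond along a segment -/

/-- **First derivative of one bond energy along a segment**: for `e + t b ≠ 0`,
`d/ds V(‖e + s b‖) |_{s = t} = (V′(r)/r)·⟪e + t b, b⟫`, `r = ‖e + t b‖`. [folklore] -/
theorem hasDerivAt_lj_along (e b : EuclideanSpace ℝ (Fin 3)) {t : ℝ} (h : e + t • b ≠ 0) :
    HasDerivAt (fun s : ℝ => lennardJones ‖e + s • b‖)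
      (deriv lennardJones ‖e + t • b‖ / ‖e + t • b‖ * ⟪e + t • b, b⟫) t := by
  have hd := pmin_hasDerivAt_bond e b h
  rwa [pmin_profile_eq_deriv_div (norm_ne_zero_iff.2 h)] at hd

/-- **Second derivative of one bond energy along a segment**: for `e + t b ≠ 0`, the derivative at `t` of
`s ↦ (V′(‖e + s b‖)/‖e + s b‖)·⟪e + s b, b⟫` is the force-constant form `Hess₀ (e + t b) b`. [folklore] -/
theorem hasDerivAt_lj_along_deriv (e b : EuclideanSpace ℝ (Fin 3)) {t : ℝ} (h : e + t • b ≠ 0) :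
    HasDerivAt (fun s : ℝ => deriv lennardJones ‖e + s • b‖ / ‖e + s • b‖ * ⟪e + s • b, b⟫)
      (Hess₀ (e + t • b) b) t := by
  have hopen : IsOpen {s : ℝ | e + s • b ≠ 0} := isOpen_ne_fun (by fun_prop) continuous_const
  refine (pmin_hasDerivAt_bond' e b h).congr_of_eventuallyEq ?_
  filter_upwards [hopen.mem_nhds h] with s hs
  rw [pmin_profile_eq_deriv_div (norm_ne_zero_iff.2 hs)]

/-- Continuity on `[0,1]` of `t ↦ Hess₀ (e + t b) w` when the segment avoids the origin. [folklore] -/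
theorem continuousOn_Hess₀_along (e b w : EuclideanSpace ℝ (Fin 3))
    (h0 : ∀ t ∈ Set.Icc (0 : ℝ) 1, e + t • b ≠ 0) :
    ContinuousOn (fun t : ℝ => Hess₀ (e + t • b) w) (Set.Icc 0 1) :=
  fun t ht => (flatDiff_continuousAt_Hess₀_chord e b w (h0 t ht)).continuousWithinAt

/-- A function continuous on `[0,1]`, weighted by `1 − t`, is interval integrable on `0..1`. [folklore] -/
theorem intervalIntegrable_one_sub_mul {f : ℝ → ℝ} (hf : ContinuousOn f (Set.Icc 0 1)) :
    IntervalIntegrable (fun t : ℝ => (1 - t) * f t) MeasureTheory.volume 0 1 :=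
  ContinuousOn.intervalIntegrable_of_Icc zero_le_one ((continuousOn_const.sub continuousOn_id).mul hf)

/-- `∫₀¹ (1 − t)·c dt = c/2`. [folklore] -/
theorem integral_one_sub_mul_const (c : ℝ) : ∫ t in (0 : ℝ)..1, (1 - t) * c = c / 2 := by
  rw [intervalIntegral.integral_mul_const, intervalIntegral.integral_sub intervalIntegrable_const
    intervalIntegral.intervalIntegrable_id, integral_id, intervalIntegral.integral_const, smul_eq_mul]
  ring

/-- **Exact second variation of one bond (Taylor with integral remainder).**  If the segment `e + t b`,
`t ∈ [0,1]`, avoids the origin, then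
`V(‖e + b‖) = V(‖e‖) + (V′(‖e‖)/‖e‖)·⟪e, b⟫ + ∫₀¹ (1 − t)·Hess₀ (e + t b) b dt`. [folklore] -/
theorem lj_pair_second_variation (e b : EuclideanSpace ℝ (Fin 3))
    (h0 : ∀ t ∈ Set.Icc (0 : ℝ) 1, e + t • b ≠ 0) :
    lennardJones ‖e + b‖ = lennardJones ‖e‖ + deriv lennardJones ‖e‖ / ‖e‖ * ⟪e, b⟫ +
      ∫ t in (0 : ℝ)..1, (1 - t) * Hess₀ (e + t • b) b := by
  -- `g(t) = φ(t) + (1 - t) φ′(t)` has `g′(t) = (1 - t) φ″(t)`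
  set g : ℝ → ℝ := fun s => lennardJones ‖e + s • b‖ +
    (1 - s) * (deriv lennardJones ‖e + s • b‖ / ‖e + s • b‖ * ⟪e + s • b, b⟫) with hg
  have hderiv : ∀ t ∈ Set.uIcc (0 : ℝ) 1, HasDerivAt g ((1 - t) * Hess₀ (e + t • b) b) t := by
    intro t ht
    rw [Set.uIcc_of_le zero_le_one] at ht
    have h1 := hasDerivAt_lj_along e b (h0 t ht)
    have h2 := hasDerivAt_lj_along_deriv e b (h0 t ht)
    have h3 : HasDerivAt (fun s : ℝ => 1 - s) (-1) t := by
      simpa using (hasDerivAt_id t).const_sub (1 : ℝ)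
    refine (h1.fun_add (h3.fun_mul h2)).congr_deriv ?_
    ring
  have hint : IntervalIntegrable (fun t : ℝ => (1 - t) * Hess₀ (e + t • b) b) MeasureTheory.volume 0 1 :=
    intervalIntegrable_one_sub_mul (continuousOn_Hess₀_along e b b h0)
  rw [intervalIntegral.integral_eq_sub_of_hasDerivAt hderiv hint]
  simp [hg]

/-- **Lower bound for one bond.**  If the segment avoids the origin and `m ≤ Hess₀ (e + t b) b` on `[0,1]`,
then `V(‖e‖) + (V′(‖e‖)/‖e‖)·⟪e, b⟫ + m/2 ≤ V(‖e + b‖)`. [folklore] -/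
theorem lj_pair_second_variation_ge (e b : EuclideanSpace ℝ (Fin 3)) {m : ℝ}
    (h0 : ∀ t ∈ Set.Icc (0 : ℝ) 1, e + t • b ≠ 0) (hm : ∀ t ∈ Set.Icc (0 : ℝ) 1, m ≤ Hess₀ (e + t • b) b) :
    lennardJones ‖e‖ + deriv lennardJones ‖e‖ / ‖e‖ * ⟪e, b⟫ + m / 2 ≤ lennardJones ‖e + b‖ := by
  rw [lj_pair_second_variation e b h0, ← integral_one_sub_mul_const m]
  have hle : ∫ t in (0 : ℝ)..1, (1 - t) * m ≤ ∫ t in (0 : ℝ)..1, (1 - t) * Hess₀ (e + t • b) b :=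
    intervalIntegral.integral_mono_on zero_le_one (intervalIntegrable_one_sub_mul continuousOn_const)
      (intervalIntegrable_one_sub_mul (continuousOn_Hess₀_along e b b h0))
      fun t ht => mul_le_mul_of_nonneg_left (hm t ht) (by linarith [ht.2])
  linarith

/-! ## The registered headline: summed over the pairs of a finite region -/

/-- **Brick `stub_segmentSecondVariation` (registered on stmt-AtomisticToContinuum-13958 for the stub
`stub_flatnessPaid`).**  For a finite configuration `y`, a displacement `u`, a region `Ω` and a set of centres `S`
such that no bond `(y i + t u i) − (y j + t u j)`, `i ∈ S`, `j ∈ Ω ∖ i`, `t ∈ [0,1]`, degenerates: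
(1) the EXACT expansion of the `S`-summed site energies `E_S(x) = Σ_{i∈S} ½ Σ_{j∈Ω∖i} V(|x_i − x_j|)` along the
segment, `E_S(y + u) = E_S(y) + Σ_{i∈S} ½ Σ_{j∈Ω∖i} (V′(r_ij)/r_ij)⟪y_i − y_j, u_i − u_j⟫ +
∫₀¹ (1 − t)·Σ_{i∈S} ½ Σ_{j∈Ω∖i} Hess₀ ((y_i + t u_i) − (y_j + t u_j)) (u_i − u_j) dt`; (2) for any minorant `m t`
of the summed second variation on `[0,1]` with `(1 − t)·m t` interval integrable, the lower bound
`E_S(y) + (first order) + ∫₀¹ (1 − t) m t dt ≤ E_S(y + u)`. [folklore] -/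
theorem stub_segmentSecondVariation : ∀ (N : ℕ) (y u : Fin N → EuclideanSpace ℝ (Fin 3)) (Ω S : Finset (Fin N)) (m : ℝ → ℝ), (∀ i ∈ S, ∀ j ∈ Ω, j ≠ i → ∀ t ∈ Set.Icc (0:ℝ) 1, (y i + t • u i) ≠ (y j + t • u j)) → (∀ t ∈ Set.Icc (0:ℝ) 1, m t ≤ ∑ i ∈ S, (1 / 2 : ℝ) * ∑ j ∈ Ω.erase i, Summit.AtomisticToContinuum.Crystallization.Theorems.PhononStabilityNegative.Hess₀ ((y i + t • u i) - (y j + t • u j)) (u i - u j)) → IntervalIntegrable (fun t => (1 - t) * m t) MeasureTheory.volume 0 1 → (∑ i ∈ S, (1 / 2 : ℝ) * ∑ j ∈ Ω.erase i, lennardJones (dist (y i + u i) (y j + u j))) = (∑ i ∈ S, (1 / 2 : ℝ) * ∑ j ∈ Ω.erase i, lennardJones (dist (y i) (y j))) + (∑ i ∈ S, (1 / 2 : ℝ) * ∑ j ∈ Ω.erase i, deriv lennardJones (dist (y i) (y j)) / dist (y i) (y j) * inner ℝ (y i - y j) (u i - u j)) + ∫ t in (0:ℝ)..1, (1 - t)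 * ∑ i ∈ S, (1 / 2 : ℝ) * ∑ j ∈ Ω.erase i, Summit.AtomisticToContinuum.Crystallization.Theorems.PhononStabilityNegative.Hess₀ ((y i + t • u i) - (y j + t • u j)) (u i - u j) ∧ (∑ i ∈ S, (1 / 2 : ℝ) * ∑ j ∈ Ω.erase i, lennardJones (dist (y i) (y j))) + (∑ i ∈ S, (1 / 2 : ℝ) * ∑ j ∈ Ω.erase i, deriv lennardJones (dist (y i) (y j)) / dist (y i) (y j) * inner ℝ (y i - y j) (u i - u j)) + ∫ t in (0:ℝ)..1, (1 - t) * m t ≤ ∑ i ∈ S, (1 / 2 : ℝ) * ∑ j ∈ Ω.erase i, lennardJones (dist (y i + u i) (y j + u j)) := by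
  intro N y u Ω S m hne hm hint
  -- bond vectors along the segment
  have hseg : ∀ (i j : Fin N) (t : ℝ), y i + t • u i - (y j + t • u j) = y i - y j + t • (u i - u j) := by
    intro i j t
    rw [smul_sub]
    abel
  have h0 : ∀ i ∈ S, ∀ j ∈ Ω.erase i, ∀ t ∈ Set.Icc (0 : ℝ) 1, y i - y j + t • (u i - u j) ≠ 0 := by
    intro i hi j hj t ht
    rw [← hseg]
    exact sub_ne_zero.2 (hne i hi j (Finset.mem_of_mem_erase hj) (Finset.ne_of_mem_erase hj) t ht)
  -- per-pair exact expansion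
  have hpair : ∀ i ∈ S, ∀ j ∈ Ω.erase i,
      lennardJones (dist (y i + u i) (y j + u j)) = lennardJones (dist (y i) (y j)) +
        deriv lennardJones (dist (y i) (y j)) / dist (y i) (y j) * ⟪y i - y j, u i - u j⟫ +
        ∫ t in (0 : ℝ)..1, (1 - t) * Hess₀ (y i + t • u i - (y j + t • u j)) (u i - u j) := by
    intro i hi j hj
    have hd1 : dist (y i + u i) (y j + u j) = ‖y i - y j + (u i - u j)‖ := by
      rw [dist_eq_norm]
      congr 1
      abel
    rw [hd1, dist_eq_norm, lj_pair_second_variation (y i - y j) (u i - u j) (h0 i hi j hj)]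
    simp only [hseg]
  -- continuity of the pair integrands on `[0,1]`
  have hcont : ∀ i ∈ S, ∀ j ∈ Ω.erase i,
      ContinuousOn (fun t : ℝ => Hess₀ (y i + t • u i - (y j + t • u j)) (u i - u j)) (Set.Icc 0 1) := by
    intro i hi j hj
    simp only [hseg]
    exact continuousOn_Hess₀_along _ _ _ (h0 i hi j hj)
  -- finite sums commute with the interval integral
  have hswap : ∫ t in (0 : ℝ)..1, (1 - t) * ∑ i ∈ S, (1 / 2 : ℝ) * ∑ j ∈ Ω.erase i,
        Hess₀ (y i + t • u i - (y j + t • u j)) (u i - u j) =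
      ∑ i ∈ S, (1 / 2 : ℝ) * ∑ j ∈ Ω.erase i,
        ∫ t in (0 : ℝ)..1, (1 - t) * Hess₀ (y i + t • u i - (y j + t • u j)) (u i - u j) := by
    calc ∫ t in (0 : ℝ)..1, (1 - t) * ∑ i ∈ S, (1 / 2 : ℝ) * ∑ j ∈ Ω.erase i,
          Hess₀ (y i + t • u i - (y j + t • u j)) (u i - u j)
        = ∫ t in (0 : ℝ)..1, ∑ i ∈ S, (1 / 2 : ℝ) * ∑ j ∈ Ω.erase i,
            (1 - t) * Hess₀ (y i + t • u i - (y j + t • u j)) (u i - u j) := by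
          refine intervalIntegral.integral_congr fun t _ => ?_
          simp only [Finset.mul_sum]
          refine Finset.sum_congr rfl fun i _ => Finset.sum_congr rfl fun j _ => ?_
          ring
      _ = ∑ i ∈ S, ∫ t in (0 : ℝ)..1, (1 / 2 : ℝ) * ∑ j ∈ Ω.erase i,
            (1 - t) * Hess₀ (y i + t • u i - (y j + t • u j)) (u i - u j) := by
          refine intervalIntegral.integral_finsetSum fun i hi => ?_
          refine ContinuousOn.intervalIntegrable_of_Icc zero_le_one (continuousOn_const.mul ?_)
          exact continuousOn_finsetSum _ fun j hj => (continuousOn_const.sub continuousOn_id).mul (hcont i hi j hj)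
      _ = ∑ i ∈ S, (1 / 2 : ℝ) * ∑ j ∈ Ω.erase i,
            ∫ t in (0 : ℝ)..1, (1 - t) * Hess₀ (y i + t • u i - (y j + t • u j)) (u i - u j) := by
          refine Finset.sum_congr rfl fun i hi => ?_
          rw [intervalIntegral.integral_const_mul, intervalIntegral.integral_finsetSum fun j hj =>
            intervalIntegrable_one_sub_mul (hcont i hi j hj)]
  -- (1) the identity
  have hident : (∑ i ∈ S, (1 / 2 : ℝ) * ∑ j ∈ Ω.erase i, lennardJones (dist (y i + u i) (y j + u j))) =
      (∑ i ∈ S, (1 / 2 : ℝ) * ∑ j ∈ Ω.erase i, lennardJones (dist (y i) (y j))) +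
      (∑ i ∈ S, (1 / 2 : ℝ) * ∑ j ∈ Ω.erase i,
        deriv lennardJones (dist (y i) (y j)) / dist (y i) (y j) * ⟪y i - y j, u i - u j⟫) +
      ∫ t in (0 : ℝ)..1, (1 - t) * ∑ i ∈ S, (1 / 2 : ℝ) * ∑ j ∈ Ω.erase i,
        Hess₀ (y i + t • u i - (y j + t • u j)) (u i - u j) := by
    rw [hswap, Finset.sum_congr rfl fun i hi => by rw [Finset.sum_congr rfl fun j hj => hpair i hi j hj]]
    simp only [Finset.sum_add_distrib, mul_add]
  refine ⟨hident, ?_⟩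
  -- (2) the lower bound
  have hHcont : ContinuousOn (fun t : ℝ => ∑ i ∈ S, (1 / 2 : ℝ) * ∑ j ∈ Ω.erase i,
      Hess₀ (y i + t • u i - (y j + t • u j)) (u i - u j)) (Set.Icc 0 1) :=
    continuousOn_finsetSum _ fun i hi => continuousOn_const.mul
      (continuousOn_finsetSum _ fun j hj => hcont i hi j hj)
  have hmono : ∫ t in (0 : ℝ)..1, (1 - t) * m t ≤ ∫ t in (0 : ℝ)..1, (1 - t) * ∑ i ∈ S, (1 / 2 : ℝ) *
      ∑ j ∈ Ω.erase i, Hess₀ (y i + t • u i - (y j + t • u j)) (u i - u j) :=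
    intervalIntegral.integral_mono_on zero_le_one hint (intervalIntegrable_one_sub_mul hHcont)
      fun t ht => mul_le_mul_of_nonneg_left (hm t ht) (by linarith [ht.2])
  rw [hident]
  linarith

end Summit.AtomisticToContinuum.Crystallization.Theorems.PhononSlackNearFieldConvexity

end
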